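import Literature.NumberTheory.DiophantineGeometry.PlaneCurveNormalFormProofs
import HarnessLib

/-!
# Weil's estimate for arbitrary plane curves over a finite field (Cafure–Matera's Lemma 5.1)

The point counts of `PlaneCurvePointCountProofs` / `PlaneCurveFactorCountProofs` for plane models in
normal form (monic in `Y`, total degree `= deg_Y`, separable over `K(X)`), transported to an
arbitrary non-zero `P ∈ K[X][Y]` (`K = 𝔽_q`) of total degree `≤ δ` — no monomial `X^j Y^k` with
`j + k > δ` — by a good shear (`PlaneCurveNormalFormProofs.exists_good_shear`) when `q > 2δ` and by
the trivial bound `#{P = 0} ≤ δ q` otherwise: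

* `exists_normalForm`: after a good shear and division by the (constant) top coefficient, the
  product `Φ` of the distinct monic irreducible factors is in normal form, with the same number of
  rational zeros as `P`, at most as many irreducible factors, and absolutely irreducible if `P` is;
* `abs_card_zeros_sub_le_of_irreducible_map` (**P1**): if `P` is absolutely irreducible,
  `|#{P = 0} - q| ≤ (δ-1)(δ-2)√q + δ³` (`δ ≥ 2`);
* `card_zeros_le_card_factors_mul_add` (**P2**): in general,
  `#{P = 0} ≤ m q + (δ-1)(δ-2)√q + δ³`, `m` the number of distinct irreducible factors of `P`.

These are the forms of Weil's estimate (1.2) / Lemma 5.1 (= Schmidt 1974, Lemma 5) of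
Cafure–Matera 2006 that enter the averaging argument (21)–(22) of the proof of their Thm. 5.2, with
the lower-order term `δ + 1 + δ²` replaced by `δ³` and `ν` (absolutely irreducible `𝔽_q`-factors)
by `m ≥ ν` (all `𝔽_q`-factors; the planes with `m ≥ 2` are controlled by the effective Bertini
theorem in any case).

No definitions, no new named facts.

## References

* A. Cafure, G. Matera, *Improved explicit estimates on the number of solutions of equations over
  a finite field*, Finite Fields Appl. 12 (2006) 155–185, eq. (1.2), Lemma 5.1, proof of
  Thm. 5.2. [CafureMatera2006]
* W. M. Schmidt, *A lower bound for the number of solutions of equations over finite fields*,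
  J. reine angew. Math. 274/275 (1975) 310–352, Lemma 5. [Schmidt1974]
-/

noncomputable section

open scoped Classical Polynomial.Bivariate
open Polynomial

namespace Literature.NumberTheory.DiophantineGeometry.PlaneShear

universe u v

/-- The shear `Φ(X, Y) ↦ Φ(X + cY, Y)` of `K[X][Y]` (local notation for the `aevalAeval` term). -/
local notation3 "sh[" K ", " c "]" =>
  (Polynomial.aevalAeval (R := K) (A := Polynomial (Polynomial K))
    (Polynomial.C Polynomial.X + Polynomial.C (Polynomial.C c) * Polynomial.X) Polynomial.X)

section NormalForm

variable {K : Type u} [Field K] [Fintype K]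

omit [Fintype K] in
/-- Undoing the inverse shear. [folklore] -/
theorem shear_shear_neg (c : K) (P : K[X][Y]) : sh[K, c] (sh[K, -c] P) = P := by
  simpa using shear_neg_shear (-c) P

omit [Fintype K] in
/-- The units of `K[X][Y]` are the non-zero constants. [folklore] -/
theorem exists_eq_C_C_of_isUnit {w : K[X][Y]} (hw : IsUnit w) : ∃ k : K, k ≠ 0 ∧ w = C (C k) := by
  obtain ⟨r, hr, rfl⟩ := Polynomial.isUnit_iff.1 hw
  obtain ⟨k, hk, rfl⟩ := Polynomial.isUnit_iff.1 hr
  exact ⟨k, hk.ne_zero, rfl⟩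

omit [Fintype K] in
/-- Zeros of a product: `Φ₁(a, b) = 0` iff some normalised irreducible factor vanishes at `(a, b)`.
[folklore] -/
theorem evalEval_eq_zero_iff_exists_normalizedFactor {Φ : K[X][Y]} (hΦ : Φ ≠ 0) (a b : K) :
    Φ.evalEval a b = 0 ↔
      ∃ u ∈ UniqueFactorizationMonoid.normalizedFactors Φ, u.evalEval a b = 0 := by
  obtain ⟨w, hw⟩ := UniqueFactorizationMonoid.prod_normalizedFactors hΦ
  obtain ⟨k, hk, hkw⟩ := exists_eq_C_C_of_isUnit w.isUnit
  conv_lhs => rw [← hw, hkw, evalEval_mul, evalEval_CC, mul_eq_zero, or_iff_left hk,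
    evalEval_multiset_prod, Multiset.prod_eq_zero_iff, Multiset.mem_map]

/-- **Normal form of a plane curve by a good shear.** Let `K = 𝔽_q`, `P ∈ K[X][Y]` non-zero of
weighted (= total) degree exactly `e` with `2e < q`. Then there is `Φ ∈ K[X][Y]` monic in `Y` of
degree `≤ e`, of total degree `deg_Y Φ`, separable over `K(X)`, with the same number of rational
zeros as `P`, with at most as many distinct irreducible factors, and absolutely irreducible
(irreducible over `σ : K → K̄`) whenever `P` is: shear by a good `c` (`exists_good_shear`), divide
by the constant top coefficient `T(c)`, and take the product of the distinct monic irreducible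
factors (each of which is the shear of a factor of `P`, hence separable in `Y`). [folklore] -/
theorem exists_normalForm {P : K[X][Y]} (hP0 : P ≠ 0) {e : ℕ}
    (hP : ∀ k, P.coeff k ≠ 0 → (P.coeff k).natDegree + k ≤ e)
    (hatt : ∃ k, P.coeff k ≠ 0 ∧ (P.coeff k).natDegree + k = e) (hq : 2 * e < Fintype.card K)
    {Kbar : Type v} [Field Kbar] (σ : K →+* Kbar) :
    ∃ Φ : K[X][Y], Φ.Monic ∧ Φ.natDegree ≤ e ∧
      (∀ i, i < Φ.natDegree → (Φ.coeff i).natDegree + i ≤ Φ.natDegree) ∧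
      (Φ.map (algebraMap K[X] (RatFunc K))).Separable ∧
      (Finset.univ.filter fun p : K × K ↦ Φ.evalEval p.1 p.2 = 0).card =
        (Finset.univ.filter fun p : K × K ↦ P.evalEval p.1 p.2 = 0).card ∧
      (UniqueFactorizationMonoid.normalizedFactors Φ).toFinset.card ≤
        (UniqueFactorizationMonoid.normalizedFactors P).toFinset.card ∧
      (Irreducible (P.map (mapRingHom σ)) → Irreducible (Φ.map (mapRingHom σ))) := by
  set φ := algebraMap K[X] (RatFunc K) with hφ
  have hφinj : Function.Injective φ := IsFractionRing.injective K[X] (RatFunc K)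
  obtain ⟨c, hTc, hgood⟩ := exists_good_shear hP0 hP hatt hq
  -- the sheared polynomial and its top coefficient
  set P' : K[X][Y] := sh[K, c] P with hP'
  set t₀ : K := ∑ k ∈ P.support, (P.coeff k).coeff (e - k) * c ^ (e - k) with ht₀
  have hP'e : P'.coeff e = C t₀ := coeff_shear_eq_C c hP
  have hP'TD : ∀ k j, e < j + k → (P'.coeff k).coeff j = 0 := coeff_coeff_shear_eq_zero c hP
  have hP'deg : P'.natDegree = e := by
    apply le_antisymm
    · rw [natDegree_le_iff_coeff_eq_zero]
      intro N hN
      ext j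
      rw [coeff_zero]
      exact hP'TD N j (by omega)
    · exact le_natDegree_of_ne_zero (by rw [hP'e]; exact C_ne_zero.2 hTc)
  have hP'lead : P'.leadingCoeff = C t₀ := by rw [leadingCoeff, hP'deg, hP'e]
  -- the monic model `Φ₁ = P' / t₀`
  set Φ₁ : K[X][Y] := C (C t₀⁻¹) * P' with hΦ₁
  have hΦ₁m : Φ₁.Monic := monic_C_mul_of_mul_leadingCoeff_eq_one (by
    rw [hP'lead, ← C_mul, inv_mul_cancel₀ hTc, C_1])
  have hΦ₁0 : Φ₁ ≠ 0 := hΦ₁m.ne_zero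
  have hΦ₁deg : Φ₁.natDegree = e := by
    rw [hΦ₁, natDegree_C_mul (C_ne_zero.2 (inv_ne_zero hTc)), hP'deg]
  have hΦ₁hdeg : ∀ i, i < Φ₁.natDegree → (Φ₁.coeff i).natDegree + i ≤ Φ₁.natDegree := by
    intro i hi
    rw [hΦ₁deg] at hi ⊢
    rw [hΦ₁, coeff_C_mul, natDegree_C_mul (inv_ne_zero hTc)]
    have : (P'.coeff i).natDegree ≤ e - i := by
      rw [natDegree_le_iff_coeff_eq_zero]
      intro j hj
      exact hP'TD i j (by omega)
    omega
  -- the distinct monic irreducible factors of `Φ₁`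
  set S₁ := (UniqueFactorizationMonoid.normalizedFactors Φ₁).toFinset with hS₁
  have hS₁mem : ∀ u ∈ S₁, u ∈ UniqueFactorizationMonoid.normalizedFactors Φ₁ := fun u hu ↦
    Multiset.mem_toFinset.1 hu
  have hS₁irr : ∀ u ∈ S₁, Irreducible u := fun u hu ↦
    UniqueFactorizationMonoid.irreducible_of_normalized_factor u (hS₁mem u hu)
  have hS₁mon : ∀ u ∈ S₁, u.Monic := fun u hu ↦
    AlgFunctionField.monic_of_mem_normalizedFactors hΦ₁m (hS₁mem u hu)
  have hS₁norm : ∀ u ∈ S₁, normalize u = u := fun u hu ↦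
    UniqueFactorizationMonoid.normalize_normalized_factor u (hS₁mem u hu)
  -- `sh[-c]` of a factor of `Φ₁` is (associated to) a factor of `P`
  have hback : ∀ u ∈ S₁, ∃ u₀ ∈ UniqueFactorizationMonoid.normalizedFactors P,
      Associated (sh[K, -c] u) u₀ := by
    intro u hu
    have hv : Irreducible (sh[K, -c] u) := (irreducible_shear_iff (-c) u).2 (hS₁irr u hu)
    have hvdvd : sh[K, -c] u ∣ P := by
      obtain ⟨w, hw⟩ := UniqueFactorizationMonoid.dvd_of_mem_normalizedFactors (hS₁mem u hu)
      -- `Φ₁ = u * w`, so `t₀⁻¹ P = sh[-c] Φ₁ = sh[-c] u * sh[-c] w`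
      have h3 : sh[K, -c] Φ₁ = C (C t₀⁻¹) * P := by
        rw [hΦ₁, map_mul, shear_CC, hP', shear_neg_shear]
      refine ⟨C (C t₀) * sh[K, -c] w, ?_⟩
      calc P = C (C t₀) * (C (C t₀⁻¹) * P) := by
            rw [← mul_assoc, ← map_mul, ← map_mul, mul_inv_cancel₀ hTc, map_one, map_one, one_mul]
        _ = C (C t₀) * (sh[K, -c] u * sh[K, -c] w) := by rw [← h3, hw, map_mul]
        _ = sh[K, -c] u * (C (C t₀) * sh[K, -c] w) := by ring
    exact UniqueFactorizationMonoid.exists_mem_normalizedFactors_of_dvd hP0 hv hvdvd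
  -- hence every factor of `Φ₁` has non-zero `Y`-derivative
  have hderiv : ∀ u ∈ S₁, derivative u ≠ 0 := by
    intro u hu hdu
    obtain ⟨u₀, hu₀, hassoc⟩ := hback u hu
    have hassoc' : Associated u (sh[K, c] u₀) := by
      have := hassoc.map (sh[K, c])
      rwa [shear_shear_neg] at this
    obtain ⟨w, hw⟩ := hassoc'
    obtain ⟨k, hk, hkw⟩ := exists_eq_C_C_of_isUnit w.isUnit
    apply hgood u₀ hu₀
    rw [← hw, derivative_mul, hdu, zero_mul, zero_add, hkw, derivative_C, mul_zero]
  -- separability over `K(X)` and pairwise coprimality of the factors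
  have hsepu : ∀ u ∈ S₁, (u.map φ).Separable := fun u hu ↦ by
    rw [separable_iff_derivative_ne_zero
      (AlgFunctionField.irreducible_map_ratFunc (hS₁mon u hu) (hS₁irr u hu)), derivative_map]
    exact (Polynomial.map_ne_zero_iff hφinj).2 (hderiv u hu)
  have hcop : ∀ u₁ ∈ S₁, ∀ u₂ ∈ S₁, u₁ ≠ u₂ → IsCoprime (u₁.map φ) (u₂.map φ) := by
    intro u₁ h₁ u₂ h₂ hne
    have hirr₁ : Irreducible (u₁.map φ) :=
      AlgFunctionField.irreducible_map_ratFunc (hS₁mon u₁ h₁) (hS₁irr u₁ h₁)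
    rw [hirr₁.coprime_iff_not_dvd]
    intro hdvd
    have h : u₁ ∣ u₂ := (map_dvd_map φ hφinj (hS₁mon u₁ h₁)).1 hdvd
    have hass : Associated u₁ u₂ := (hS₁irr u₁ h₁).associated_of_dvd (hS₁irr u₂ h₂) h
    exact hne (eq_of_monic_of_associated (hS₁mon u₁ h₁) (hS₁mon u₂ h₂) hass)
  -- the radical `Φ`
  set Φ : K[X][Y] := ∏ u ∈ S₁, u with hΦ
  have hΦm : Φ.Monic := monic_prod_of_monic _ _ hS₁mon
  have hΦdvd : Φ ∣ Φ₁ := by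
    have h1 : Φ = (UniqueFactorizationMonoid.normalizedFactors Φ₁).dedup.prod := by
      rw [hΦ, Finset.prod_eq_multiset_prod, hS₁, Multiset.toFinset_val, Multiset.map_id']
    rw [h1]
    exact dvd_trans (Multiset.prod_dvd_prod_of_le (Multiset.dedup_le _))
      (UniqueFactorizationMonoid.prod_normalizedFactors hΦ₁0).dvd
  have hΦdeg : Φ.natDegree ≤ e := hΦ₁deg ▸ natDegree_le_of_dvd hΦdvd hΦ₁0
  have hΦnF : UniqueFactorizationMonoid.normalizedFactors Φ = S₁.val := by
    have h1 : Φ = S₁.val.prod := by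
      rw [hΦ, Finset.prod_eq_multiset_prod, Multiset.map_id']
    rw [h1, UniqueFactorizationMonoid.normalizedFactors_prod_eq _ (fun u hu ↦ hS₁irr u hu)]
    conv_rhs => rw [← Multiset.map_id' S₁.val]
    exact Multiset.map_congr rfl fun u hu ↦ hS₁norm u hu
  refine ⟨Φ, hΦm, hΦdeg, ?_, ?_, ?_, ?_, ?_⟩
  · -- total degree `= deg_Y Φ`
    have hWu : ∀ u ∈ S₁, (u.support.sup fun k ↦ (u.coeff k).natDegree + k) ≤ u.natDegree := by
      intro u hu
      have h := AlgFunctionField.natDegree_coeff_add_le_of_mem_normalizedFactors hΦ₁m hΦ₁hdeg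
        (hS₁mem u hu)
      refine Finset.sup_le fun k hk ↦ ?_
      rw [mem_support_iff] at hk
      rcases lt_trichotomy k u.natDegree with hlt | heq | hgt
      · exact h k hlt
      · rw [heq, (hS₁mon u hu).coeff_natDegree, natDegree_one, zero_add]
      · exact absurd (coeff_eq_zero_of_natDegree_lt hgt) hk
    have hWΦ : (Φ.support.sup fun k ↦ (Φ.coeff k).natDegree + k) ≤ Φ.natDegree := by
      rw [hΦ, sup_support_prod S₁ (fun u ↦ u) (fun u hu ↦ (hS₁irr u hu).ne_zero),
        natDegree_prod_of_monic _ _ hS₁mon]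
      exact Finset.sum_le_sum hWu
    intro i _
    by_cases hi0 : Φ.coeff i = 0
    · rw [hi0, natDegree_zero, zero_add]; omega
    · exact (le_sup_support hi0).trans hWΦ
  · -- separable over `K(X)`
    rw [hΦ, Polynomial.map_prod]
    exact separable_prod' hcop hsepu
  · -- same number of rational zeros as `P`
    have h1 : (Finset.univ.filter fun p : K × K ↦ Φ.evalEval p.1 p.2 = 0) =
        Finset.univ.filter fun p : K × K ↦ P'.evalEval p.1 p.2 = 0 := by
      refine Finset.filter_congr fun p _ ↦ ?_
      have hP'0 : P' ≠ 0 := fun h0 ↦ hΦ₁0 (by rw [hΦ₁, h0, mul_zero])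
      rw [show P' = C (C t₀) * Φ₁ by
        rw [hΦ₁, ← mul_assoc, ← map_mul, ← map_mul, mul_inv_cancel₀ hTc, map_one, map_one,
          one_mul]]
      rw [evalEval_mul, evalEval_CC, mul_eq_zero, or_iff_right hTc,
        evalEval_eq_zero_iff_exists_normalizedFactor hΦ₁0, hΦ, ← coe_evalEvalRingHom, map_prod,
        Finset.prod_eq_zero_iff]
      simp only [coe_evalEvalRingHom, hS₁, Multiset.mem_toFinset]
    rw [h1, hP']
    exact card_filter_evalEval_shear c P
  · -- at most as many factors as `P`
    rw [hΦnF, Finset.val_toFinset]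
    refine Finset.card_le_card_of_injOn (fun u ↦ normalize (sh[K, -c] u)) (fun u hu ↦ ?_)
      (fun u₁ h₁ u₂ h₂ heq ↦ ?_)
    · obtain ⟨u₀, hu₀, hassoc⟩ := hback u hu
      rw [Finset.mem_coe, Multiset.mem_toFinset]
      have : normalize (sh[K, -c] u) = u₀ := by
        rw [← UniqueFactorizationMonoid.normalize_normalized_factor u₀ hu₀,
          normalize_eq_normalize_iff]
        exact ⟨hassoc.dvd, hassoc.symm.dvd⟩
      dsimp only
      rw [this]
      exact hu₀
    · rw [normalize_eq_normalize_iff] at heq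
      have h1 : u₁ ∣ u₂ := by
        have := map_dvd (sh[K, c]) heq.1
        rwa [shear_shear_neg, shear_shear_neg] at this
      have h2 : u₂ ∣ u₁ := by
        have := map_dvd (sh[K, c]) heq.2
        rwa [shear_shear_neg, shear_shear_neg] at this
      rw [← hS₁norm u₁ h₁, ← hS₁norm u₂ h₂, normalize_eq_normalize_iff]
      exact ⟨h1, h2⟩
  · -- absolute irreducibility is preserved
    intro hPirr
    have hP'irr : Irreducible (P'.map (mapRingHom σ)) :=
      (irreducible_map_shear_iff σ c P).2 hPirr
    have hΦ₁irr : Irreducible (Φ₁.map (mapRingHom σ)) := by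
      rw [hΦ₁, Polynomial.map_mul, map_C, coe_mapRingHom, map_C]
      exact (irreducible_isUnit_mul (isUnit_C.2 (isUnit_C.2
        (IsUnit.mk0 _ ((map_ne_zero σ).2 (inv_ne_zero hTc)))))).2 hP'irr
    have hΦ₁irrK : Irreducible Φ₁ := hΦ₁m.irreducible_of_irreducible_map _ _ hΦ₁irr
    have hS₁eq : S₁ = {Φ₁} := by
      rw [hS₁, UniqueFactorizationMonoid.normalizedFactors_irreducible hΦ₁irrK,
        hΦ₁m.normalize_eq_self]
      rfl
    have hΦeq : Φ = Φ₁ := by rw [hΦ, hS₁eq, Finset.prod_singleton]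
    rw [hΦeq]
    exact hΦ₁irr

end NormalForm

/-! ### The final estimates for arbitrary plane curves -/

section Final

variable {K : Type u} [Field K] [Fintype K]

omit [Fintype K] in
/-- From the `coeff`-`coeff` form of "total degree `≤ δ`" to the weighted form. [folklore] -/
theorem natDegree_coeff_add_le_of_coeff_coeff_eq_zero {P : K[X][Y]} {δ : ℕ}
    (hTD : ∀ k j, δ < j + k → (P.coeff k).coeff j = 0) :
    ∀ k, P.coeff k ≠ 0 → (P.coeff k).natDegree + k ≤ δ := by
  intro k hk
  have h1 : (P.coeff k).coeff (P.coeff k).natDegree ≠ 0 := by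
    rw [← leadingCoeff]; exact leadingCoeff_ne_zero.2 hk
  by_contra hlt
  exact h1 (hTD k _ (by omega))

/-- **Weil's estimate for an absolutely irreducible plane curve (Cafure–Matera Lemma 5.1 / eq.
(1.2), two-sided, arbitrary coordinates).** Let `K = 𝔽_q`, `δ ≥ 2`, and let `P ∈ K[X][Y]` have no
monomial `X^j Y^k` with `j + k > δ` and irreducible image in `K̄[X][Y]` for an embedding `σ` of `K`
into an algebraically closed field. Then `|#{(a,b) ∈ K² : P(a,b) = 0} - q| ≤ (δ-1)(δ-2)√q + δ³`.
For `q > 2δ` this is `abs_card_zeros_sub_le` applied to the normal form of `P`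
(`exists_normalForm`); for `q ≤ 2δ` it follows from `#{P = 0} ≤ δq`.
[cite: CafureMatera2006, Lemma 5.1] -/
theorem abs_card_zeros_sub_le_of_irreducible_map {δ : ℕ} (hδ : 2 ≤ δ) {P : K[X][Y]}
    (hTD : ∀ k j, δ < j + k → (P.coeff k).coeff j = 0)
    {Kbar : Type v} [Field Kbar] [IsAlgClosed Kbar] (σ : K →+* Kbar)
    (hirr : Irreducible (P.map (mapRingHom σ))) :
    |((Finset.univ.filter fun p : K × K ↦ P.evalEval p.1 p.2 = 0).card : ℝ) - Fintype.card K| ≤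
      ((δ - 1) * (δ - 2) : ℕ) * √(Fintype.card K : ℝ) + (δ : ℝ) ^ 3 := by
  have hP0 : P ≠ 0 := fun h0 ↦ hirr.ne_zero (by rw [h0, Polynomial.map_zero])
  set q := Fintype.card K with hq
  set N := (Finset.univ.filter fun p : K × K ↦ P.evalEval p.1 p.2 = 0).card with hN
  have hsq : 0 ≤ √(q : ℝ) := Real.sqrt_nonneg _
  have hnn : (0 : ℝ) ≤ ((δ - 1) * (δ - 2) : ℕ) * √(q : ℝ) := mul_nonneg (Nat.cast_nonneg _) hsq
  have hδr : (2 : ℝ) ≤ δ := by exact_mod_cast hδ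
  have hNle : N ≤ δ * q := card_filter_evalEval_le_mul hP0 hTD
  have hNle' : (N : ℝ) ≤ δ * q := by exact_mod_cast hNle
  by_cases hqδ : 2 * δ < q
  · -- normal form and the function-field count
    have hPg := natDegree_coeff_add_le_of_coeff_coeff_eq_zero hTD
    set e := P.support.sup fun k ↦ (P.coeff k).natDegree + k with he
    have heδ : e ≤ δ := Finset.sup_le fun k hk ↦ hPg k (mem_support_iff.1 hk)
    obtain ⟨Φ, hΦm, hΦdeg, hΦhdeg, hΦsep, hΦcount, -, hΦirr⟩ :=
      exists_normalForm hP0 (fun k hk ↦ le_sup_support hk) (exists_eq_sup_support hP0)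
        (by omega) σ
    have hirrΦ := hΦirr hirr
    have hW := AlgFunctionField.abs_card_zeros_sub_le hΦm hΦhdeg σ hirrΦ hΦsep
    rw [hΦcount] at hW
    set d := Φ.natDegree with hd
    have hd1 : 1 ≤ d := by
      by_contra h0
      have : Φ = 1 := eq_one_of_monic_natDegree_zero hΦm (by omega)
      exact hirrΦ.not_isUnit (by rw [this, Polynomial.map_one]; exact isUnit_one)
    have hdδ : d ≤ δ := hΦdeg.trans heδ
    -- compare the error terms
    have h1 : ((d - 1) * (d - 2) : ℕ) ≤ (δ - 1) * (δ - 2) :=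
      Nat.mul_le_mul (Nat.sub_le_sub_right hdδ 1) (Nat.sub_le_sub_right hdδ 2)
    have h1' : (((d - 1) * (d - 2) : ℕ) : ℝ) * √(q : ℝ) ≤ ((δ - 1) * (δ - 2) : ℕ) * √(q : ℝ) :=
      mul_le_mul_of_nonneg_right (by exact_mod_cast h1) hsq
    have h2 : (d * (1 + d * (d - 1)) : ℕ) + 1 ≤ δ ^ 3 := by
      rcases hdδ.lt_or_eq with hlt | heq
      · have h3 : d * (1 + d * (d - 1)) ≤ d ^ 3 := by
          have : 1 + d * (d - 1) ≤ d * d := by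
            rcases d with _ | d
            · omega
            · simp only [Nat.add_sub_cancel]; nlinarith
          calc d * (1 + d * (d - 1)) ≤ d * (d * d) := Nat.mul_le_mul_left _ this
            _ = d ^ 3 := by ring
        have h4 : d ^ 3 + 1 ≤ (d + 1) ^ 3 := by nlinarith
        have h5 : (d + 1) ^ 3 ≤ δ ^ 3 := Nat.pow_le_pow_left (by omega) 3
        omega
      · subst heq
        rcases d with _ | d
        · omega
        · simp only [Nat.add_sub_cancel]
          have : 1 ≤ d := by omega
          nlinarith
    have h2' : ((d * (1 + d * (d - 1)) : ℕ) : ℝ) + 1 ≤ (δ : ℝ) ^ 3 := by exact_mod_cast h2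
    rw [abs_le] at hW ⊢
    constructor <;> linarith [hW.1, hW.2]
  · -- the trivial regime `q ≤ 2δ`
    have hq' : (q : ℝ) ≤ 2 * δ := by exact_mod_cast (not_lt.1 hqδ)
    have hq0 : (0 : ℝ) ≤ q := Nat.cast_nonneg _
    have hN0 : (0 : ℝ) ≤ N := Nat.cast_nonneg _
    have hδ2 : (2 : ℝ) * δ ≤ (δ : ℝ) ^ 2 := by nlinarith
    have h1 : (2 : ℝ) * δ ≤ (δ : ℝ) ^ 3 := by
      have : (0 : ℝ) ≤ δ * ((δ : ℝ) ^ 2 - 2) := mul_nonneg (by linarith) (by nlinarith)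
      nlinarith [this]
    have h2 : (δ : ℝ) * q ≤ (δ : ℝ) ^ 3 := by
      have : (0 : ℝ) ≤ δ * ((δ : ℝ) ^ 2 - q) := mul_nonneg (by linarith) (by linarith)
      nlinarith [this]
    rw [abs_le]
    constructor <;> linarith

/-- **Upper Weil bound for an arbitrary plane curve, factor by factor (Cafure–Matera Lemma 5.1,
upper half, arbitrary coordinates).** Let `K = 𝔽_q`, `δ ≥ 1`, and let `P ∈ K[X][Y]` be non-zero
with no monomial `X^j Y^k` with `j + k > δ`; let `m` be the number of its distinct normalised
irreducible factors in `K[X][Y]`. Then `#{(a,b) ∈ K² : P(a,b) = 0} ≤ m q + (δ-1)(δ-2)√q + δ³`.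
For `q > 2δ` this is `card_zeros_le_card_factors_mul` applied to the normal form of `P`; for
`q ≤ 2δ` it follows from `#{P = 0} ≤ δq`. [cite: CafureMatera2006, Lemma 5.1] -/
theorem card_zeros_le_card_factors_mul_add {δ : ℕ} (hδ : 1 ≤ δ) {P : K[X][Y]} (hP0 : P ≠ 0)
    (hTD : ∀ k j, δ < j + k → (P.coeff k).coeff j = 0) :
    ((Finset.univ.filter fun p : K × K ↦ P.evalEval p.1 p.2 = 0).card : ℝ) ≤
      (UniqueFactorizationMonoid.normalizedFactors P).toFinset.card * (Fintype.card K : ℝ) +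
        ((δ - 1) * (δ - 2) : ℕ) * √(Fintype.card K : ℝ) + (δ : ℝ) ^ 3 := by
  set q := Fintype.card K with hq
  set N := (Finset.univ.filter fun p : K × K ↦ P.evalEval p.1 p.2 = 0).card with hN
  set m := (UniqueFactorizationMonoid.normalizedFactors P).toFinset.card with hm
  have hsq : 0 ≤ √(q : ℝ) := Real.sqrt_nonneg _
  have hnn : (0 : ℝ) ≤ ((δ - 1) * (δ - 2) : ℕ) * √(q : ℝ) := mul_nonneg (Nat.cast_nonneg _) hsq
  have hδr : (1 : ℝ) ≤ δ := by exact_mod_cast hδ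
  have hq0 : (0 : ℝ) ≤ q := Nat.cast_nonneg _
  -- a unit has no zeros
  by_cases hunit : IsUnit P
  · obtain ⟨k, hk, hkP⟩ := exists_eq_C_C_of_isUnit hunit
    have h0 : (Finset.univ.filter fun p : K × K ↦ P.evalEval p.1 p.2 = 0) = ∅ :=
      Finset.filter_false_of_mem fun p _ ↦ by rw [hkP, evalEval_CC]; exact hk
    have hN0 : (N : ℝ) = 0 := by rw [hN, h0, Finset.card_empty, Nat.cast_zero]
    rw [hN0]
    positivity
  have hm1 : 1 ≤ m := by
    have hpos : 0 < UniqueFactorizationMonoid.normalizedFactors P :=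
      (UniqueFactorizationMonoid.normalizedFactors_pos P hP0).2 hunit
    obtain ⟨u, hu⟩ := Multiset.exists_mem_of_ne_zero hpos.ne'
    exact Finset.card_pos.2 ⟨u, Multiset.mem_toFinset.2 hu⟩
  have hNle : N ≤ δ * q := card_filter_evalEval_le_mul hP0 hTD
  have hNle' : (N : ℝ) ≤ δ * q := by exact_mod_cast hNle
  have hm1' : (1 : ℝ) ≤ m := by exact_mod_cast hm1
  by_cases hqδ : 2 * δ < q
  · -- normal form and the function-field count
    have hPg := natDegree_coeff_add_le_of_coeff_coeff_eq_zero hTD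
    set e := P.support.sup fun k ↦ (P.coeff k).natDegree + k with he
    have heδ : e ≤ δ := Finset.sup_le fun k hk ↦ hPg k (mem_support_iff.1 hk)
    obtain ⟨Φ, hΦm, hΦdeg, hΦhdeg, hΦsep, hΦcount, hΦcard, -⟩ :=
      exists_normalForm hP0 (fun k hk ↦ le_sup_support hk) (exists_eq_sup_support hP0)
        (by omega) (RingHom.id K)
    have hW := AlgFunctionField.card_zeros_le_card_factors_mul hΦm hΦhdeg hΦsep
    rw [hΦcount] at hW
    set d := Φ.natDegree with hd
    set mΦ := (UniqueFactorizationMonoid.normalizedFactors Φ).toFinset.card with hmΦ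
    have hdδ : d ≤ δ := hΦdeg.trans heδ
    have hmΦm : (mΦ : ℝ) ≤ m := by exact_mod_cast hΦcard
    have hmΦd : (mΦ : ℝ) ≤ δ := by
      exact_mod_cast (AlgFunctionField.card_normalizedFactors_toFinset_le hΦm hΦsep).trans hdδ
    have h1 : ((d - 1) * (d - 2) : ℕ) ≤ (δ - 1) * (δ - 2) :=
      Nat.mul_le_mul (Nat.sub_le_sub_right hdδ 1) (Nat.sub_le_sub_right hdδ 2)
    have h1' : (((d - 1) * (d - 2) : ℕ) : ℝ) * √(q : ℝ) ≤ ((δ - 1) * (δ - 2) : ℕ) * √(q : ℝ) :=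
      mul_le_mul_of_nonneg_right (by exact_mod_cast h1) hsq
    have h2 : (d * (d * (d - 1)) : ℕ) ≤ δ * (δ * (δ - 1)) :=
      Nat.mul_le_mul hdδ (Nat.mul_le_mul hdδ (Nat.sub_le_sub_right hdδ 1))
    have h2' : ((d * (d * (d - 1)) : ℕ) : ℝ) ≤ ((δ * (δ * (δ - 1)) : ℕ) : ℝ) := by
      exact_mod_cast h2
    have h3 : ((δ * (δ * (δ - 1)) : ℕ) : ℝ) + δ ≤ (δ : ℝ) ^ 3 := by
      rcases δ with _ | δ
      · omega
      · simp only [Nat.add_sub_cancel]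
        push_cast
        nlinarith
    have hmq : (mΦ : ℝ) * (q + 1) ≤ m * q + δ := by nlinarith
    linarith
  · -- the trivial regime `q ≤ 2δ`
    have hq' : (q : ℝ) ≤ 2 * δ := by exact_mod_cast (not_lt.1 hqδ)
    have h1 : ((δ : ℝ) - 1) * q ≤ (δ : ℝ) ^ 3 := by
      nlinarith [sq_nonneg ((δ : ℝ) - 1)]
    nlinarith

end Final


end Literature.NumberTheory.DiophantineGeometry.PlaneShear
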